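import Literature.AnabelianGeometry.SemiGraphs.TreeSystemBoundedGeodesics
import Literature.AnabelianGeometry.SemiGraphs.TemperedLevelData
import HarnessLib

/-!
# [SemiAnbd] Thm. 3.7 (iii) beyond finite semi-graphs: the input (FIX∞), second clause, in the bounded case

Mochizuki, *Semi-graphs of anabelioids*, Publ. RIMS **42** (2006), Thm. 3.7 (iii), p. 41, with the
author's *Comments* (2020) (6). [cite: MochizukiSemiAnbd2006, Thm. 3.7(iii) p.41]

PROOF-ONLY (cell abc-iut, layer L3, GAP row G-t6g3-2 «Thm 3.7 (iii)/Cor 3.9 beyond finite 𝒢», sub-row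
E2-bounded, ruling α27; seat abc-iut-w5-d160; no definition).  Over the level data
`D : VerticialLevelData 𝒢 c` of a chart (`TemperedLevelData.lean`, abc-iut-L3-t11/t6 interface), the
reduction of abc-iut-L3-t10's SHAPES memo (`SHAPES-Ggt6g32.md` §(c)) needs, for every compact `C ≠ 1`,
(FIX∞): a compatible `C`-fixed vertex system of the trees `D.tree j`, and (`hadj`) for two compatible
`C`-fixed vertex systems `x`, `x'` and every level with `x j ≠ x' j`, an edge of `D.tree j` joining them
and fixed by `C`.  This file discharges `hadj` whenever the level distances `dist (x j) (x' j)` are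
BOUNDED, modulo the tree-level estrangement input «`C` fixes no compatible system of branch-pairs of the
trees above any level» (a hypothesis BINDER, shaped as abc-iut-L3-t11's `hnobp` with the trees in place of
the finite levels; D-0067: no new `Prop` definition):
`VerticialLevelData.hadj_of_bounded_dist`.  The unbounded case is the open sub-row G-t6g3-2b (memo
§(e)/(f)); at abc-iut-w4-d075's test semi-graph `𝒢⋆` the hypotheses are vacuous (one compatible fixed
system only), so nothing false is asserted there.  Pure combinatorics of the tree system:
`SemiGraph.adjacent_of_bounded_dist_of_noFixedBranchPairSystem` (`TreeSystemBoundedGeodesics.lean`).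
-/

namespace Literature.AnabelianGeometry.SemiGraphs

namespace ProfiniteSemiGraph

namespace VerticialLevelData

open CategoryTheory

universe v u

variable {𝒢 : ProfiniteSemiGraph.{u}} {c : TemperedPiChart 𝒢} (D : VerticialLevelData.{v} 𝒢 c)

/-- **(FIX∞), second clause, bounded case** ([SemiAnbd] Thm. 3.7 (iii) beyond finite semi-graphs, over
the level data of a chart): let `C ≠ 1` be a subgroup of `π₁^temp` fixing no compatible system of
branch-pairs of the trees `D.tree j` above any level (tree-level estrangement input `hnobp`), and let
`x`, `x'` be compatible systems of `C`-fixed vertices whose level distances are bounded.  Then at every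
level with `x j ≠ x' j` the two vertices are joined by an edge of `D.tree j` fixed by `C`.
[cite: MochizukiSemiAnbd2006, Thm. 3.7(iii) p.41] -/
theorem hadj_of_bounded_dist (C : Subgroup c.G) (hC : C ≠ ⊥)
    (hnobp : ∀ (j₀ : D.J) (w : ∀ i : {i : D.J // j₀ ≤ i}, (D.tree i.1).Vertex)
      (β β' : ∀ i : {i : D.J // j₀ ≤ i}, (D.tree i.1).Branch),
      (∀ i, β i ≠ β' i ∧ (D.tree i.1).abuts (β i) = some (w i) ∧ (D.tree i.1).abuts (β' i) = some (w i)) →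
      (∀ ⦃i i' : {i : D.J // j₀ ≤ i}⦄ (h : i.1 ≤ i'.1), (D.trans h).vertexMap (w i') = w i ∧
        (D.trans h).branchMap (β i') = β i ∧ (D.trans h).branchMap (β' i') = β' i) →
      (∀ (i : {i : D.J // j₀ ≤ i}), ∀ g ∈ C, (D.act i.1 g).hom.vertexMap (w i) = w i ∧
        (D.act i.1 g).hom.branchMap (β i) = β i ∧ (D.act i.1 g).hom.branchMap (β' i) = β' i) → C = ⊥)
    (x x' : ∀ j, (D.tree j).Vertex)
    (hx : ∀ ⦃i j : D.J⦄ (h : i ≤ j), (D.trans h).vertexMap (x j) = x i)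
    (hx' : ∀ ⦃i j : D.J⦄ (h : i ≤ j), (D.trans h).vertexMap (x' j) = x' i)
    (hfx : ∀ g ∈ C, ∀ j, (D.act j g).hom.vertexMap (x j) = x j)
    (hfx' : ∀ g ∈ C, ∀ j, (D.act j g).hom.vertexMap (x' j) = x' j)
    (hbdd : ∃ N : ℕ, ∀ j, (D.tree j).subdivision.dist (Sum.inl (x j)) (Sum.inl (x' j)) ≤ N)
    (j : D.J) (hne : x j ≠ x' j) :
    ∃ (e : (D.tree j).Edge) (b b' : (D.tree j).Branch), b ≠ b' ∧
      (D.tree j).edgeOf b = e ∧ (D.tree j).edgeOf b' = e ∧ (D.tree j).abuts b = some (x j) ∧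
      (D.tree j).abuts b' = some (x' j) ∧ ∀ g ∈ C, (D.act j g).hom.edgeMap e = e := by
  obtain ⟨e, b, b', hbb', hbe, hb'e, hbx, hb'x, hfix⟩ :=
    SemiGraph.adjacent_of_bounded_dist_of_noFixedBranchPairSystem C D.tree D.isTree D.act D.trans
      (fun j₀ w β β' h1 h2 h3 => hnobp j₀ w β β' h1 h2 fun i g hg => h3 i ⟨g, hg⟩) hC x x' hx hx'
      (fun j γ => hfx γ.1 γ.2 j) (fun j γ => hfx' γ.1 γ.2 j) hbdd j hne
  exact ⟨e, b, b', hbb', hbe, hb'e, hbx, hb'x, fun g hg => hfix ⟨g, hg⟩⟩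

end VerticialLevelData

end ProfiniteSemiGraph

end Literature.AnabelianGeometry.SemiGraphs
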